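import Summits.CriticalPhenomena.PercolationContinuityZ3.Theorems.PercNearOneGluingNoHeavyConstsClusterSquareClusterSeparated
import HarnessLib

/-!
# A clash forces a branch vertex together with BOTH initial segments of the clash paths

builds on p205010 (kernel theorem, internal audit signed; external expert review pending)

PAPER-2 track "percolation constants", part (ii), seat `prim-consts-1`, gen 17 (lane index
`run/shared/lean/prim/consts/CONSTANTS.md`, row A19; memo `FROM-prim-consts-1-g17-THREE-COPY-STRUCTURE.md` §2b).
Support file for the crux `NoHeavyLowerTail` (stmt-CriticalPhenomena-4575; `--supports`).  Theorems only; no sorries.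

`Consts.exists_branch_of_clash''`: the combinatorial core of `…ClusterSquareClusterSeparated` / `…ClusterSquareLinked`, recording in
addition the initial segment `y → v` of the `η'`-path from the clash vertex to `c` (a `θ`-walk avoiding `c`; its vertices lie in
`C_c(η')`).  It feeds the "both sides linked" criterion `…ClusterSquareBilinked`.
Reference: N. Gladkov, arXiv:2408.08457v2 (2024), Thm. 4.3, Def. 4.2, Example 2.5.
-/

noncomputable section

open Classical

namespace Summit.CriticalPhenomena.PercolationContinuityZ3.Theorems

open MeasureTheory Finset Literature.Probability.LatticeModels Literature.Probability.Percolation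
open Literature.Probability.Percolation.DecisionTree Literature.Probability.Percolation.BHK2006
open Literature.Probability.Percolation.TargetExploration Literature.Probability.Percolation.ClusterConditioning

namespace Consts

variable {V : Type*} [Fintype V]

/-- **A `b`-clash forces a branch vertex, with both initial segments of the clash paths** (sharpening of
`Consts.exists_branch_of_clash'`): some vertex `v` outside `K ∪ {a, b, c}` (`K = C_a(ω)`) has at least three `H`-neighbours, is joined
to `b` in `ω`, to `c` in `θ`, to the clash vertex `y` by an `ω`-walk avoiding `b` AND by a `θ`-walk avoiding `c`.
[folklore; combinatorial input for Gladkov2024, Thm. 4.3 / Ex. 2.5] -/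
theorem exists_branch_of_clash'' (H : SimpleGraph V) [DecidableRel H.Adj] {a b c k y : V} {ω θ : Set (Sym2 V)}
    (hωH : ∀ u v, (openGraph ω).Adj u v → H.Adj u v) (hθH : ∀ u v, (openGraph θ).Adj u v → H.Adj u v)
    (hθK : ∀ u v, (openGraph θ).Adj u v → ¬ (openGraph ω).Reachable a v)
    (hab : ¬ (openGraph ω).Reachable a b) (hbc : ¬ (openGraph ω).Reachable b c) (hbc' : ¬ (openGraph θ).Reachable b c)
    (hk : (openGraph ω).Reachable a k) (hky : H.Adj k y) (hby : (openGraph ω).Reachable b y)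
    (hcy : (openGraph θ).Reachable c y) :
    ∃ v, v ≠ a ∧ v ≠ b ∧ v ≠ c ∧ ¬ (openGraph ω).Reachable a v ∧ 3 ≤ H.degree v ∧ (openGraph ω).Reachable b v ∧
      (openGraph θ).Reachable c v ∧ (∃ W : (openGraph ω).Walk y v, b ∉ W.support) ∧
      ∃ W₂ : (openGraph θ).Walk y v, c ∉ W₂.support := by
  obtain ⟨P₀⟩ := hby.symm
  obtain ⟨Q₀⟩ := hcy.symm
  set P := P₀.bypass with hPdef
  have hP : P.IsPath := P₀.bypass_isPath
  set Q := Q₀.bypass with hQdef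
  have hQ : Q.IsPath := Q₀.bypass_isPath
  -- the vertices of `P` other than its endpoint `b`
  set S : Set V := {v | ∃ i, i < P.length ∧ P.getVert i = v} with hSdef
  have hreachP : ∀ i, (openGraph ω).Reachable y (P.getVert i) := fun i => ⟨P.takeUntil _ (P.getVert_mem_support i)⟩
  have hreachQ : ∀ x ∈ Q.support, (openGraph θ).Reachable y x := fun x hx => ⟨Q.takeUntil x hx⟩
  have hyb : y ≠ b := by rintro rfl; exact hbc' hcy.symm
  have hlen : 0 < P.length := by
    by_contra h0
    have h0' : P.length = 0 := by omega
    have := P.getVert_length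
    rw [h0', P.getVert_zero] at this
    exact hyb this
  have hyS : y ∈ S := ⟨0, hlen, P.getVert_zero⟩
  have hcS : c ∉ S := by
    rintro ⟨i, -, hi⟩
    exact hbc (hby.trans (hi ▸ hreachP i))
  have hPi_notK : ∀ j, ¬ (openGraph ω).Reachable a (P.getVert j) := fun j h =>
    hab (h.trans ((hreachP j).symm.trans hby.symm))
  have hPi_ne_b : ∀ j, j < P.length → P.getVert j ≠ b := by
    intro j hj h
    have := hP.getVert_injOn (by simp only [Set.mem_setOf_eq]; omega) (by simp only [Set.mem_setOf_eq]; exact le_rfl)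
      (h.trans P.getVert_length.symm)
    omega
  -- the `θ`-path from `y` to `c` leaves `S` through a dart `d`; `d.fst = P i`
  obtain ⟨d, hd, hdS, hdS'⟩ := Q.exists_boundary_dart S hyS hcS
  obtain ⟨i, hi, hiv⟩ := hdS
  have hfst_mem : d.fst ∈ Q.support := Q.dart_fst_mem_support_of_mem_darts hd
  have hsnd_reach : (openGraph θ).Reachable y d.snd := hreachQ _ (Q.dart_snd_mem_support_of_mem_darts hd)
  have hsnd_ne_b : d.snd ≠ b := by
    intro h; rw [h] at hsnd_reach; exact hbc' (hsnd_reach.symm.trans hcy.symm)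
  have hsnd_K : ¬ (openGraph ω).Reachable a d.snd := hθK _ _ d.adj
  have hadj_snd : H.Adj (P.getVert i) d.snd := hiv ▸ hθH _ _ d.adj
  have hadj_succ : H.Adj (P.getVert i) (P.getVert (i + 1)) := hωH _ _ (P.adj_getVert_succ hi)
  have hsucc_ne_snd : P.getVert (i + 1) ≠ d.snd := by
    intro h
    by_cases hi1 : i + 1 < P.length
    · exact hdS' ⟨i + 1, hi1, h⟩
    · have hi1' : i + 1 = P.length := by omega
      rw [hi1', P.getVert_length] at h
      exact hsnd_ne_b h.symm
  -- the predecessor of `P i`: `k` if `i = 0`, else `P (i - 1)`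
  obtain ⟨u, hadj_pred, hpred_ne_snd, hpred_ne_succ⟩ :
      ∃ u, H.Adj (P.getVert i) u ∧ u ≠ d.snd ∧ u ≠ P.getVert (i + 1) := by
    by_cases hi0 : i = 0
    · subst hi0
      refine ⟨k, by rw [P.getVert_zero]; exact hky.symm, fun h => hsnd_K (h ▸ hk), fun h => hPi_notK 1 (h ▸ hk)⟩
    · refine ⟨P.getVert (i - 1), ?_, fun h => hdS' ⟨i - 1, by omega, h⟩, fun h => ?_⟩
      · have h := hωH _ _ (P.adj_getVert_succ (show i - 1 < P.length by omega))
        rw [show i - 1 + 1 = i from by omega] at h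
        exact h.symm
      · have := hP.getVert_injOn (by simp only [Set.mem_setOf_eq]; omega) (by simp only [Set.mem_setOf_eq]; omega) h
        omega
  have h3 : ({u, P.getVert (i + 1), d.snd} : Finset V) ⊆ H.neighborFinset (P.getVert i) := by
    intro x hx
    simp only [Finset.mem_insert, Finset.mem_singleton] at hx
    rw [SimpleGraph.mem_neighborFinset]
    rcases hx with rfl | rfl | rfl
    exacts [hadj_pred, hadj_succ, hadj_snd]
  have hcard : ({u, P.getVert (i + 1), d.snd} : Finset V).card = 3 := by
    rw [Finset.card_eq_three]
    exact ⟨u, P.getVert (i + 1), d.snd, hpred_ne_succ, hpred_ne_snd, hsucc_ne_snd, rfl⟩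
  refine ⟨P.getVert i, fun h => hPi_notK i (by rw [h]), hPi_ne_b i hi, fun h => hcS ⟨i, hi, h⟩, hPi_notK i, ?_,
    hby.trans (hreachP i), hcy.trans (hiv ▸ hreachQ _ hfst_mem),
    ⟨P.takeUntil _ (P.getVert_mem_support i), P.endpoint_notMem_support_takeUntil hP _ (hPi_ne_b i hi).symm⟩,
    ⟨(Q.takeUntil d.fst hfst_mem).copy rfl hiv.symm, by
      rw [SimpleGraph.Walk.support_copy]
      exact Q.endpoint_notMem_support_takeUntil hQ hfst_mem fun h => hcS ⟨i, hi, hiv.trans h.symm⟩⟩⟩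
  rw [← SimpleGraph.card_neighborFinset_eq_degree, ← hcard]
  exact Finset.card_le_card h3


end Consts

end Summit.CriticalPhenomena.PercolationContinuityZ3.Theorems
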